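import Summits.QuantumFields.YangMills.Theorems.BalabanUVNodesN15CovariantLandauCovariance
import HarnessLib

/-!
# Route «BalabanUVNodes», node N15 = NE2, road (c) — PROGRAMME (P-R), III: `Δ′_a(U)` IS POSITIVE DEFINITE FOR EVERY BACKGROUND, `G′(U)` and `(Q′G′²Q′*)⁻¹` ARE GENUINE
# INVERSES, `I − R(U)` IS A SYMMETRIC IDEMPOTENT, AND `R(U)` IS THE ORTHOGONAL PROJECTION ONTO `Δ^U N(Q′(U))` — (3.21) and p. 395 l. 1–3 in the model (dag-n15-c g22, n15-c∕199)

Cell `pub-ymgap`, seat `pub-ymgap-dag-n15-c` (generation g22; R134 (a), s1; HUMAN RULING D-0062; chair R424 venue).  `bears_on: R4∕N15 · K3⁸ SpineGivenEndpointR13SepCoPHV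
(stmt-QuantumFields-27366)`; filed `--supports stmt-QuantumFields-27366 --as helper` — COUNT-NEUTRAL.  Finite linear algebra ([folklore]); no `def`; 0 `sorry`; NO estimate.
Imports BY NAME n15-c∕198 `…N15CovariantLandauCovariance` (`bpt_stair_succ`, `stair_leg_end`, `stair_zero`, `stair_last`, `mprod_telescope`'s siblings) and through it n15-c∕197
(`cgrad`, `csavg`, `claplA`, `cGreen`, `cSop`, `cPi`, `cR`, `landauCov`, `cgrad_mulVec`, `csavg_mulVec`), n15-c∕181 (`mprod`, `cvaLeg`, `cvaStair`).  Nothing in the tree modified.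

WHY.  The print, p. 394–395: *«R = R(U) is an orthogonal projection in the Hilbert space L²(Ω₀, g) onto the subspace ℛ = Δ^η_U N(Q′), N(Q′) = {λ : Q′λ = 0}. (3.21) … Rf = (I −
G′Q′*(Q′G′²Q′*)⁻¹Q′G′)f, (3.25) where G′ = G′(U) = (Δ′_a)⁻¹. We do not know yet if the operators in the above formula are well defined. Assuming some regularity of the
configuration U it can be easily shown that the operator Δ′_a is positive. This implies positivity of the operators G′, Q′G′²Q′*, hence the existence of the operator R.»*
In the finite MODEL of n15-c∕197 (whole torus, one averaging level, invertible one-bond transporters) NO regularity is needed: `⟨λ, Δ′_a λ⟩ = ‖D_Uλ‖² + a‖Q′(U)λ‖²`, and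
`D_Uλ = 0` makes `λ` covariantly constant, so its transported block average is its value at the block's base point; `Q′(U)λ = 0` kills that value, and invertibility of the
transports kills `λ` on the whole block.  Hence `G′(U)` and `(Q′G′²Q′*)⁻¹` (invertible because `Q′(U)*` is injective: read it at the base points) are genuine two-sided
inverses, `I − R(U)` of (3.25) is a symmetric idempotent fixing `Range(G′Q′*)`, and `R(U) = 1 − (I − R)` is the symmetric idempotent with `Range R = ker(Q′G′) = Δ′_a(N(Q′)) =
Δ^U N(Q′)` — (3.21) typed.  These are the facts the flat identification (n15-c∕200) and every perturbative row of the sequel rest on.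

RESULTS ([folklore] linear algebra; tags mark the printed sentence each theorem transcribes in the model — nothing printed is asserted as an estimate).
* §1 `dotProduct_claplA` (`⟨λ,Δ′_aλ⟩ = ‖Dλ‖² + a‖Q′λ‖²`), `covConst_of_cgrad_eq_zero` (`Dλ = 0 ⇒ λ(x) = T_ν(x)λ(x+e_ν)`), `mprod_mulVec_chain`, `cvaLeg_mulVec_covConst`,
  ★ `cvaStair_mulVec_covConst` (`T(Γ_{y,x})λ(x) = λ(n·y)` for covariantly constant `λ`), `csavg_covConst` (`Q′λ = λ ∘ base point`), `isUnit_mprod`, `isUnit_cvaStair`,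
  ★★ **`eq_zero_of_claplA_mulVec_eq_zero`**, ★★ **`isUnit_claplA`** (p.395 l.1–3, unconditionally), `claplA_mul_cGreen`∕`cGreen_mul_claplA`, `claplA_transpose`, `cGreen_transpose`.
* §2 `csavg_transpose_mulVec_base` (`(Q′ᵀw)(n·y) = n^{−(d+1)}w(y)`), `csavg_transpose_injective`, `dotProduct_cSop`, ★ **`isUnit_cSop`**, `cSop_transpose`.
* §3 ★ `cPi_transpose`, ★ `cPi_mul_cPi` (symmetric idempotent), `cPi_mul_cGreen_csavg_transpose` (`(I−R)·G′Q′ᵀ = G′Q′ᵀ`), `cR_transpose`, `cR_mul_cR`, ★ `csavg_cGreen_mul_cR`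
  (`Q′G′·R = 0`: `Range R ⊆ ker(Q′G′)`), ★ `cR_mulVec_of_mem_ker` (`Q′G′w = 0 ⇒ Rw = w`) — together: `R(U)` is the orthogonal projection onto `ker(Q′G′) = Δ^U N(Q′)` ((3.21));
  `landauCov_transpose`.

HONEST FRAMING ∕ LIMITS.  Finite linear algebra on the model carriers; no estimate, no decay, no regularity class; MODEL READING as n15-c∕197.  NOT [Balaban1985BackgroundPropagators]
Thms 3.1–3.3 (decay of `G′`, `R`, `G`); NE2⁺ NOT PRINTED; N15 of record untouched (DISCHARGED AS CONSUMED, p687738); counts UNMOVED (typed 28∕28); one finite 𝕋⁴ at fixed ε per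
index — NOT infinite volume ∕ OS ∕ mass gap ∕ Clay.  Restate-immune (no Theses import).
-/

noncomputable section

open scoped BigOperators Matrix
open Finset

namespace Summit.QuantumFields.YangMills.BalabanUVNodes.N15.CovLandau

open Literature.MathematicalPhysics.QuantumFieldTheory.Balaban1983to89
open Literature.MathematicalPhysics.QuantumFieldTheory.Balaban1983to89.B5Prop11Plancherel (Tor fine unitVec)
open Literature.MathematicalPhysics.QuantumFieldTheory.Balaban1983to89.B5Block118 (bpt)
open Literature.MathematicalPhysics.QuantumFieldTheory.King1986.Torus (blockOf)
open Summit.QuantumFields.YangMills.BalabanUVNodes.N15.VectorPiece (bondAt stair stair_of_lt stair_self stair_of_gt blockCoords blockCoords_bpt bpt_blockCoords)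
open Summit.QuantumFields.YangMills.BalabanUVNodes.N15.DefectKernel (kingBlockOf_bpt)
open Summit.QuantumFields.YangMills.BalabanUVNodes.N15.CovAvg (mprod mprod_zero mprod_succ mprod_congr cvaLeg cvaStair)

variable {d : ℕ} (M : Fin (d + 1) → ℕ) [∀ μ, NeZero (M μ)] (n : ℕ) [NeZero n] {ι : Type} [Fintype ι] [DecidableEq ι]

/-! ## §1 `Δ′_a(U)` is positive definite, `G′(U)` is its two-sided inverse -/

section Positivity

/-- THE QUADRATIC FORM: `⟨λ, Δ′_a(U)λ⟩ = ⟨D_Uλ, D_Uλ⟩ + a·⟨Q′(U)λ, Q′(U)λ⟩`. [cite: Balaban1985BackgroundPropagators, (3.23)–(3.24) p.394] -/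
theorem dotProduct_claplA (T : Fin (d + 1) → Tor (fine n M) → Matrix ι ι ℝ) (a : ℝ) (v : Tor (fine n M) × ι → ℝ) :
    v ⬝ᵥ (claplA M n T a *ᵥ v) = (cgrad M n T *ᵥ v) ⬝ᵥ (cgrad M n T *ᵥ v) + a * ((csavg M n T *ᵥ v) ⬝ᵥ (csavg M n T *ᵥ v)) := by
  rw [claplA, Matrix.add_mulVec, dotProduct_add, Matrix.smul_mulVec, dotProduct_smul, ← Matrix.mulVec_mulVec, ← Matrix.mulVec_mulVec,
    Matrix.dotProduct_mulVec, ← Matrix.mulVec_transpose, Matrix.transpose_transpose, Matrix.dotProduct_mulVec v, ← Matrix.mulVec_transpose, Matrix.transpose_transpose,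
    smul_eq_mul]

/-- COVARIANT CONSTANCY: `D_Tλ = 0` ⟹ `λ(x, ·) = T_ν(x)·λ(x + e_ν, ·)` for every site and direction. [cite: Balaban1985BackgroundPropagators, (3.23) p.394 (shape)] -/
theorem covConst_of_cgrad_eq_zero {T : Fin (d + 1) → Tor (fine n M) → Matrix ι ι ℝ} {v : Tor (fine n M) × ι → ℝ} (h : cgrad M n T *ᵥ v = 0) (x : Tor (fine n M)) (ν : Fin (d + 1)) :
    (fun i => v (x, i)) = T ν x *ᵥ fun j => v (x + unitVec (fine n M) ν, j) := by
  funext i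
  have hn : (n : ℝ) ≠ 0 := Nat.cast_ne_zero.mpr (NeZero.ne n)
  have h1 := congrFun h ((x, ν), i)
  rw [cgrad_mulVec, Pi.zero_apply, mul_eq_zero] at h1
  rcases h1 with h1 | h1
  · exact absurd h1 hn
  · rw [sub_eq_zero] at h1
    rw [← h1]
    rfl

omit [DecidableEq ι] in
/-- A CHAIN OF TRANSPORTS: if `w(t) = F_t·w(t+1)` for `t < N` then `w(0) = (Π_{t<N} F_t)·w(N)`. [folklore] -/
theorem mprod_mulVec_chain [DecidableEq ι] (F : ℕ → Matrix ι ι ℝ) (w : ℕ → ι → ℝ) (N : ℕ) (h : ∀ t < N, w t = F t *ᵥ w (t + 1)) : w 0 = mprod F N *ᵥ w N := by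
  induction N with
  | zero => rw [mprod_zero, Matrix.one_mulVec]
  | succ N ih => rw [mprod_succ, ← Matrix.mulVec_mulVec, ← h N (Nat.lt_succ_self N), ih fun t ht => h t (Nat.lt_succ_of_lt ht)]

/-- Transport along one leg of a covariantly constant field: `cvaLeg·λ(top) = λ(bottom)`. [folklore] -/
theorem cvaLeg_mulVec_covConst {T : Fin (d + 1) → Tor (fine n M) → Matrix ι ι ℝ} {v : Tor (fine n M) × ι → ℝ} (h : cgrad M n T *ᵥ v = 0)
    (y : Tor M) (a : Fin (d + 1) → Fin n) (μ : Fin (d + 1)) :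
    (fun i => v (bpt n M y (stair a μ ⟨0, Nat.pos_of_ne_zero (NeZero.ne n)⟩), i)) =
      cvaLeg M n (fun ν b => T ν b.1) y a μ 0 *ᵥ fun i => v (bpt n M y (stair a μ ⟨(a μ : ℕ) % n, Nat.mod_lt _ (Nat.pos_of_ne_zero (NeZero.ne n))⟩), i) := by
  have hn : 0 < n := Nat.pos_of_ne_zero (NeZero.ne n)
  have key := mprod_mulVec_chain (fun t => T μ (bondAt n M y a μ 0 t).1) (fun t i => v (bpt n M y (stair a μ ⟨t % n, Nat.mod_lt _ hn⟩), i)) (a μ) (by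
    intro t ht
    have ht1 : t + 1 < n := lt_of_le_of_lt (Nat.succ_le_of_lt ht) (a μ).isLt
    have htn : t < n := Nat.lt_of_succ_lt ht1
    have hb : (bondAt n M y a μ 0 t).1 = bpt n M y (stair a μ ⟨t % n, Nat.mod_lt _ hn⟩) := rfl
    rw [hb, covConst_of_cgrad_eq_zero M n h _ μ]
    simp only [Nat.mod_eq_of_lt htn, Nat.mod_eq_of_lt ht1]
    rw [bpt_stair_succ M n y a μ t ht1])
  simp only [Nat.zero_mod] at key
  exact key

/-- ★ TRANSPORT ALONG THE STAIRCASE of a covariantly constant field: `T(Γ_{y,x})·λ(x) = λ(n·y)`. [cite: Balaban1985BackgroundPropagators, (3.19) p.393 (shape)] -/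
theorem cvaStair_mulVec_covConst {T : Fin (d + 1) → Tor (fine n M) → Matrix ι ι ℝ} {v : Tor (fine n M) × ι → ℝ} (h : cgrad M n T *ᵥ v = 0)
    (y : Tor M) (a : Fin (d + 1) → Fin n) :
    (fun i => v (bpt n M y 0, i)) = cvaStair M n (fun ν b => T ν b.1) y a 0 *ᵥ fun i => v (bpt n M y a, i) := by
  have hn : 0 < n := Nat.pos_of_ne_zero (NeZero.ne n)
  set z : ℕ → Tor (fine n M) := fun i => if hi : i < d + 1 then bpt n M y (stair a ⟨i, hi⟩ ⟨0, hn⟩) else bpt n M y a with hz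
  have hzi : ∀ (i : ℕ) (hi : i < d + 1), z i = bpt n M y (stair a ⟨i, hi⟩ ⟨0, hn⟩) := fun i hi => by rw [hz]; exact dif_pos hi
  have htop : ∀ (i : ℕ) (hi : i < d + 1), bpt n M y (stair a ⟨i, hi⟩ ⟨(a ⟨i, hi⟩ : ℕ) % n, Nat.mod_lt _ hn⟩) = z (i + 1) := by
    intro i hi
    by_cases h' : i + 1 < d + 1
    · rw [hzi (i + 1) h', stair_leg_end n a ⟨i, hi⟩ h' _ (Nat.mod_eq_of_lt (a ⟨i, hi⟩).isLt)]
    · have hi' : i = d := by omega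
      have hzd : z (i + 1) = bpt n M y a := by rw [hz]; exact dif_neg h'
      rw [hzd]; congr 1
      have hlast := stair_last n a (Nat.lt_succ_self d); revert hlast hi; rw [hi']; exact fun h hlast => hlast
  have key := mprod_mulVec_chain (fun i => if hi : i < d + 1 then cvaLeg M n (fun ν b => T ν b.1) y a ⟨i, hi⟩ 0 else 1) (fun i j => v (z i, j)) (d + 1) (by
    intro i hi
    rw [dif_pos hi, hzi i hi, cvaLeg_mulVec_covConst M n h, htop i hi])
  have hz0 : z 0 = bpt n M y 0 := by rw [hzi 0 (Nat.zero_lt_succ _), stair_zero]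
  have hzN : z (d + 1) = bpt n M y a := by rw [hz]; exact dif_neg (lt_irrefl _)
  rw [hz0, hzN] at key
  exact key

/-- ★ A COVARIANTLY CONSTANT FIELD AVERAGES TO ITS BASE-POINT VALUES: `(Q′_Tλ)(y) = λ(n·y)`. [cite: Balaban1985BackgroundPropagators, (3.19) p.393] -/
theorem csavg_covConst {T : Fin (d + 1) → Tor (fine n M) → Matrix ι ι ℝ} {v : Tor (fine n M) × ι → ℝ} (h : cgrad M n T *ᵥ v = 0) (y : Tor M) (i : ι) :
    (csavg M n T *ᵥ v) (y, i) = v (bpt n M y 0, i) := by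
  have hn : (n : ℝ) ≠ 0 := Nat.cast_ne_zero.mpr (NeZero.ne n)
  rw [csavg_mulVec]
  have hterm : ∀ a : Fin (d + 1) → Fin n, ∑ j, cvaStair M n (fun μ b => T μ b.1) y a 0 i j * v (bpt n M y a, j) = v (bpt n M y 0, i) := by
    intro a
    have := congrFun (cvaStair_mulVec_covConst M n h y a) i
    rw [this]
    rfl
  simp only [hterm, Finset.sum_const, Finset.card_univ, nsmul_eq_mul]
  rw [Fintype.card_pi, Finset.prod_const, Fintype.card_fin, Finset.card_univ, Fintype.card_fin, ← mul_assoc]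
  push_cast
  rw [inv_mul_cancel₀ (pow_ne_zero _ hn), one_mul]

omit [DecidableEq ι] in
/-- A product of invertible matrices is invertible. [folklore] -/
theorem isUnit_mprod [DecidableEq ι] {F : ℕ → Matrix ι ι ℝ} {N : ℕ} (hF : ∀ t < N, IsUnit (F t)) : IsUnit (mprod F N) := by
  induction N with
  | zero => rw [mprod_zero]; exact isUnit_one
  | succ N ih => rw [mprod_succ]; exact (ih fun t ht => hF t (Nat.lt_succ_of_lt ht)).mul (hF N (Nat.lt_succ_self N))

omit [∀ μ, NeZero (M μ)] in
/-- Staircase transports of invertible one-bond transporters are invertible. [folklore] -/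
theorem isUnit_cvaStair {T : Fin (d + 1) → Tor (fine n M) → Matrix ι ι ℝ} (hT : ∀ ν x, IsUnit (T ν x)) (y : Tor M) (a : Fin (d + 1) → Fin n) (ν : Fin (d + 1)) :
    IsUnit (cvaStair M n (fun μ b => T μ b.1) y a ν) :=
  isUnit_mprod fun i _ => by
    split_ifs
    exact isUnit_mprod fun t _ => hT _ _

/-- ★★ **`Δ′_a(U)` HAS TRIVIAL KERNEL** for `a > 0` and invertible one-bond transporters — no regularity of the background needed in the finite model.
[cite: Balaban1985BackgroundPropagators, p.395 l.1–3 («it can be easily shown that the operator Δ′_a is positive»)] -/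
theorem eq_zero_of_claplA_mulVec_eq_zero {T : Fin (d + 1) → Tor (fine n M) → Matrix ι ι ℝ} (hT : ∀ ν x, IsUnit (T ν x)) {a : ℝ} (ha : 0 < a)
    {v : Tor (fine n M) × ι → ℝ} (h : claplA M n T a *ᵥ v = 0) : v = 0 := by
  have hq := dotProduct_claplA M n T a v
  rw [h, dotProduct_zero] at hq
  have h1 : 0 ≤ (cgrad M n T *ᵥ v) ⬝ᵥ (cgrad M n T *ᵥ v) := dotProduct_star_self_nonneg _
  have h2 : 0 ≤ (csavg M n T *ᵥ v) ⬝ᵥ (csavg M n T *ᵥ v) := dotProduct_star_self_nonneg _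
  have hD : cgrad M n T *ᵥ v = 0 := dotProduct_self_eq_zero.mp (by nlinarith)
  have hQ : csavg M n T *ᵥ v = 0 := dotProduct_self_eq_zero.mp (by nlinarith)
  funext ⟨x, i⟩
  -- `x = n·y + a`; the value at the base point vanishes by `Q′v = 0`, and transports back to `x`
  have hbase : (fun j => v (bpt n M (blockCoords n M x).1 0, j)) = 0 := by
    funext j
    rw [← csavg_covConst M n hD, hQ]
    rfl
  have hx := cvaStair_mulVec_covConst M n hD (blockCoords n M x).1 (blockCoords n M x).2
  rw [hbase, bpt_blockCoords] at hx
  have hinj := (Matrix.mulVec_injective_iff_isUnit.mpr (isUnit_cvaStair M n hT (blockCoords n M x).1 (blockCoords n M x).2 0))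
  have := congrFun (hinj (hx.symm.trans (Matrix.mulVec_zero _).symm)) i
  simpa using this

/-- ★★ **`Δ′_a(U)` IS INVERTIBLE** (`a > 0`, invertible transporters). [cite: Balaban1985BackgroundPropagators, p.395 l.1–3] -/
theorem isUnit_claplA {T : Fin (d + 1) → Tor (fine n M) → Matrix ι ι ℝ} (hT : ∀ ν x, IsUnit (T ν x)) {a : ℝ} (ha : 0 < a) : IsUnit (claplA M n T a) := by
  refine Matrix.mulVec_injective_iff_isUnit.mp fun v w hvw => ?_
  rw [← sub_eq_zero]
  exact eq_zero_of_claplA_mulVec_eq_zero M n hT ha (by rw [Matrix.mulVec_sub, hvw, sub_self])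

/-- `Δ′_a·G′ = 1`. [cite: Balaban1985BackgroundPropagators, (3.25) p.394 («G′ = (Δ′_a)⁻¹»)] -/
theorem claplA_mul_cGreen {T : Fin (d + 1) → Tor (fine n M) → Matrix ι ι ℝ} (hT : ∀ ν x, IsUnit (T ν x)) {a : ℝ} (ha : 0 < a) : claplA M n T a * cGreen M n T a = 1 :=
  Matrix.mul_nonsing_inv _ ((Matrix.isUnit_iff_isUnit_det _).mp (isUnit_claplA M n hT ha))

/-- `G′·Δ′_a = 1`. [cite: Balaban1985BackgroundPropagators, (3.25) p.394] -/
theorem cGreen_mul_claplA {T : Fin (d + 1) → Tor (fine n M) → Matrix ι ι ℝ} (hT : ∀ ν x, IsUnit (T ν x)) {a : ℝ} (ha : 0 < a) : cGreen M n T a * claplA M n T a = 1 :=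
  Matrix.nonsing_inv_mul _ ((Matrix.isUnit_iff_isUnit_det _).mp (isUnit_claplA M n hT ha))

/-- `Δ′_a` is symmetric. [folklore] -/
theorem claplA_transpose (T : Fin (d + 1) → Tor (fine n M) → Matrix ι ι ℝ) (a : ℝ) : (claplA M n T a)ᵀ = claplA M n T a := by
  rw [claplA, Matrix.transpose_add, Matrix.transpose_smul, Matrix.transpose_mul, Matrix.transpose_mul, Matrix.transpose_transpose, Matrix.transpose_transpose]

/-- `G′` is symmetric. [folklore] -/
theorem cGreen_transpose (T : Fin (d + 1) → Tor (fine n M) → Matrix ι ι ℝ) (a : ℝ) : (cGreen M n T a)ᵀ = cGreen M n T a := by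
  rw [cGreen, Matrix.transpose_nonsing_inv, claplA_transpose]

end Positivity

/-! ## §2 `Q′G′²Q′*` is invertible -/

section Sop

/-- `Q′(U)ᵀ` READ AT THE BASE POINTS: `(Q′_Tᵀ w)(n·y, j) = n^{−(d+1)}·w(y, j)` (the staircase to the base point is empty). [cite: Balaban1985BackgroundPropagators, (3.19) p.393 (shape)] -/
theorem csavg_transpose_mulVec_base (T : Fin (d + 1) → Tor (fine n M) → Matrix ι ι ℝ) (w : Tor M × ι → ℝ) (y : Tor M) (j : ι) :
    ((csavg M n T)ᵀ *ᵥ w) (bpt n M y 0, j) = ((n : ℝ) ^ (d + 1))⁻¹ * w (y, j) := by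
  simp only [Matrix.mulVec, dotProduct, Matrix.transpose_apply, csavg, kingBlockOf_bpt, blockCoords_bpt]
  rw [Fintype.sum_prod_type]
  simp only [ite_mul, zero_mul]
  rw [Finset.sum_eq_single y (fun y' _ hy' => by simp [Ne.symm hy']) (fun h => (h (Finset.mem_univ _)).elim)]
  simp only [if_true]
  have h1 : cvaStair M n (fun (μ : Fin (d + 1)) (b : Tor (fine n M) × Fin (d + 1)) => T μ b.1) y 0 0 = 1 :=
    CovAvg.mprod_eq_one fun i _ => by
      split_ifs
      rw [cvaLeg, Pi.zero_apply, Fin.val_zero, mprod_zero]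
  rw [h1]
  simp only [Matrix.one_apply, mul_ite, mul_one, mul_zero, ite_mul, zero_mul, Finset.sum_ite_eq', Finset.mem_univ, if_true]

/-- `Q′(U)ᵀ` is injective (equivalently `Q′(U)` is onto). [cite: Balaban1985BackgroundPropagators, p.395 l.2–3 (mechanism)] -/
theorem csavg_transpose_injective (T : Fin (d + 1) → Tor (fine n M) → Matrix ι ι ℝ) {w : Tor M × ι → ℝ} (h : (csavg M n T)ᵀ *ᵥ w = 0) : w = 0 := by
  have hn : ((n : ℝ) ^ (d + 1))⁻¹ ≠ 0 := inv_ne_zero (pow_ne_zero _ (Nat.cast_ne_zero.mpr (NeZero.ne n)))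
  funext ⟨y, j⟩
  have := csavg_transpose_mulVec_base M n T w y j
  rw [h, Pi.zero_apply] at this
  exact (mul_eq_zero.mp this.symm).resolve_left hn

/-- THE QUADRATIC FORM OF `Q′G′²Q′ᵀ`: `⟨w, Q′G′²Q′ᵀw⟩ = ‖G′Q′ᵀw‖²`. [folklore] -/
theorem dotProduct_cSop (T : Fin (d + 1) → Tor (fine n M) → Matrix ι ι ℝ) (a : ℝ) (w : Tor M × ι → ℝ) :
    w ⬝ᵥ (cSop M n T a *ᵥ w) = (cGreen M n T a *ᵥ ((csavg M n T)ᵀ *ᵥ w)) ⬝ᵥ (cGreen M n T a *ᵥ ((csavg M n T)ᵀ *ᵥ w)) := by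
  rw [cSop, ← Matrix.mulVec_mulVec, ← Matrix.mulVec_mulVec, Matrix.dotProduct_mulVec, ← Matrix.mulVec_transpose, ← Matrix.mulVec_mulVec,
    Matrix.dotProduct_mulVec _ (cGreen M n T a), ← Matrix.mulVec_transpose, cGreen_transpose]

/-- ★ **`Q′G′²Q′*` IS INVERTIBLE** (`a > 0`, invertible transporters). [cite: Balaban1985BackgroundPropagators, p.395 l.2–3 («positivity of … Q′G′²Q′*, hence the existence of the operator R»)] -/
theorem isUnit_cSop {T : Fin (d + 1) → Tor (fine n M) → Matrix ι ι ℝ} (hT : ∀ ν x, IsUnit (T ν x)) {a : ℝ} (ha : 0 < a) : IsUnit (cSop M n T a) := by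
  refine Matrix.mulVec_injective_iff_isUnit.mp fun v w hvw => ?_
  rw [← sub_eq_zero]
  have h0 : cSop M n T a *ᵥ (v - w) = 0 := by rw [Matrix.mulVec_sub, hvw, sub_self]
  have hq := dotProduct_cSop M n T a (v - w)
  rw [h0, dotProduct_zero] at hq
  have h1 : cGreen M n T a *ᵥ ((csavg M n T)ᵀ *ᵥ (v - w)) = 0 := dotProduct_self_eq_zero.mp hq.symm
  have h2 := congrArg (claplA M n T a).mulVec h1
  rw [Matrix.mulVec_mulVec, claplA_mul_cGreen M n hT ha, Matrix.one_mulVec, Matrix.mulVec_zero] at h2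
  exact csavg_transpose_injective M n T h2

/-- `Q′G′²Q′ᵀ` is symmetric. [folklore] -/
theorem cSop_transpose (T : Fin (d + 1) → Tor (fine n M) → Matrix ι ι ℝ) (a : ℝ) : (cSop M n T a)ᵀ = cSop M n T a := by
  rw [cSop, Matrix.transpose_mul, Matrix.transpose_mul, Matrix.transpose_transpose, Matrix.transpose_mul, cGreen_transpose]
  simp only [Matrix.mul_assoc]

end Sop

/-! ## §3 `I − R(U)` and `R(U)` are complementary symmetric idempotents; `Range R = ker(Q′G′) = Δ^U N(Q′)` -/

section Projection

/-- ★ `I − R(U)` is symmetric. [cite: Balaban1985BackgroundPropagators, (3.21) p.394 («orthogonal projection»)] -/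
theorem cPi_transpose (T : Fin (d + 1) → Tor (fine n M) → Matrix ι ι ℝ) (a : ℝ) : (cPi M n T a)ᵀ = cPi M n T a := by
  rw [cPi, Matrix.transpose_mul, Matrix.transpose_mul, Matrix.transpose_mul, Matrix.transpose_mul, Matrix.transpose_transpose, cGreen_transpose,
    Matrix.transpose_nonsing_inv, cSop_transpose]
  simp only [Matrix.mul_assoc]

/-- ★ `I − R(U)` IS IDEMPOTENT. [cite: Balaban1985BackgroundPropagators, (3.21)∕(3.25) p.394] -/
theorem cPi_mul_cPi {T : Fin (d + 1) → Tor (fine n M) → Matrix ι ι ℝ} (hT : ∀ ν x, IsUnit (T ν x)) {a : ℝ} (ha : 0 < a) : cPi M n T a * cPi M n T a = cPi M n T a := by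
  have hS : (cSop M n T a)⁻¹ * cSop M n T a = 1 := Matrix.nonsing_inv_mul _ ((Matrix.isUnit_iff_isUnit_det _).mp (isUnit_cSop M n hT ha))
  calc cPi M n T a * cPi M n T a
      = cGreen M n T a * (csavg M n T)ᵀ * ((cSop M n T a)⁻¹ * (csavg M n T * (cGreen M n T a * cGreen M n T a) * (csavg M n T)ᵀ)) *
          (cSop M n T a)⁻¹ * csavg M n T * cGreen M n T a := by simp only [cPi, Matrix.mul_assoc]
    _ = cPi M n T a := by rw [← cSop, hS, Matrix.mul_one, cPi]

/-- `I − R(U)` FIXES `Range(G′Q′ᵀ)`. [cite: Balaban1985BackgroundPropagators, (3.25) p.394 (mechanism)] -/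
theorem cPi_mul_cGreen_csavg_transpose {T : Fin (d + 1) → Tor (fine n M) → Matrix ι ι ℝ} (hT : ∀ ν x, IsUnit (T ν x)) {a : ℝ} (ha : 0 < a) :
    cPi M n T a * (cGreen M n T a * (csavg M n T)ᵀ) = cGreen M n T a * (csavg M n T)ᵀ := by
  have hS : (cSop M n T a)⁻¹ * cSop M n T a = 1 := Matrix.nonsing_inv_mul _ ((Matrix.isUnit_iff_isUnit_det _).mp (isUnit_cSop M n hT ha))
  calc cPi M n T a * (cGreen M n T a * (csavg M n T)ᵀ)
      = cGreen M n T a * (csavg M n T)ᵀ * ((cSop M n T a)⁻¹ * (csavg M n T * (cGreen M n T a * cGreen M n T a) * (csavg M n T)ᵀ)) := by simp only [cPi, Matrix.mul_assoc]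
    _ = cGreen M n T a * (csavg M n T)ᵀ := by rw [← cSop, hS, Matrix.mul_one]

/-- `R(U)` is symmetric. [cite: Balaban1985BackgroundPropagators, (3.21) p.394] -/
theorem cR_transpose (T : Fin (d + 1) → Tor (fine n M) → Matrix ι ι ℝ) (a : ℝ) : (cR M n T a)ᵀ = cR M n T a := by
  rw [cR, Matrix.transpose_sub, Matrix.transpose_one, cPi_transpose]

/-- `R(U)` is idempotent. [cite: Balaban1985BackgroundPropagators, (3.21) p.394] -/
theorem cR_mul_cR {T : Fin (d + 1) → Tor (fine n M) → Matrix ι ι ℝ} (hT : ∀ ν x, IsUnit (T ν x)) {a : ℝ} (ha : 0 < a) : cR M n T a * cR M n T a = cR M n T a := by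
  rw [cR, Matrix.sub_mul, Matrix.mul_sub, Matrix.mul_sub, Matrix.one_mul, Matrix.one_mul, Matrix.mul_one, cPi_mul_cPi M n hT ha, sub_self, sub_zero]

/-- ★ `Q′G′·R(U) = 0`: THE RANGE OF `R` LIES IN `ker(Q′G′) = Δ′_a(N(Q′)) = Δ^U N(Q′)`. [cite: Balaban1985BackgroundPropagators, (3.21) p.394 («onto the subspace ℛ = Δ^η_U N(Q′)»)] -/
theorem csavg_cGreen_mul_cR {T : Fin (d + 1) → Tor (fine n M) → Matrix ι ι ℝ} (hT : ∀ ν x, IsUnit (T ν x)) {a : ℝ} (ha : 0 < a) :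
    csavg M n T * cGreen M n T a * cR M n T a = 0 := by
  have hS : cSop M n T a * (cSop M n T a)⁻¹ = 1 := Matrix.mul_nonsing_inv _ ((Matrix.isUnit_iff_isUnit_det _).mp (isUnit_cSop M n hT ha))
  have h1 : csavg M n T * cGreen M n T a * cPi M n T a = csavg M n T * cGreen M n T a := by
    calc csavg M n T * cGreen M n T a * cPi M n T a
        = (csavg M n T * (cGreen M n T a * cGreen M n T a) * (csavg M n T)ᵀ) * (cSop M n T a)⁻¹ * (csavg M n T * cGreen M n T a) := by simp only [cPi, Matrix.mul_assoc]
      _ = csavg M n T * cGreen M n T a := by rw [← cSop, hS, Matrix.one_mul]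
  rw [cR, Matrix.mul_sub, Matrix.mul_one, h1, sub_self]

/-- ★ `R(U)` FIXES `ker(Q′G′)`: `Q′G′w = 0 ⇒ R w = w` — with `csavg_cGreen_mul_cR`, `cR_transpose`, `cR_mul_cR`: `R(U)` is THE orthogonal projection onto `Δ^U N(Q′(U))`.
[cite: Balaban1985BackgroundPropagators, (3.21)–(3.22) p.394] -/
theorem cR_mulVec_of_mem_ker (T : Fin (d + 1) → Tor (fine n M) → Matrix ι ι ℝ) (a : ℝ) {w : Tor (fine n M) × ι → ℝ} (hw : csavg M n T *ᵥ (cGreen M n T a *ᵥ w) = 0) :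
    cR M n T a *ᵥ w = w := by
  rw [cR, Matrix.sub_mulVec, Matrix.one_mulVec, cPi]
  simp only [← Matrix.mulVec_mulVec]
  rw [hw, Matrix.mulVec_zero, Matrix.mulVec_zero, Matrix.mulVec_zero, sub_zero]

/-- The covariant Landau term is symmetric. [folklore] -/
theorem landauCov_transpose (T : Fin (d + 1) → Tor (fine n M) → Matrix ι ι ℝ) (a : ℝ) : (landauCov M n T a)ᵀ = landauCov M n T a := by
  rw [landauCov, Matrix.transpose_mul, Matrix.transpose_mul, Matrix.transpose_transpose, cPi_transpose, Matrix.mul_assoc]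

end Projection

end Summit.QuantumFields.YangMills.BalabanUVNodes.N15.CovLandau

end
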